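import Mathlib
import Literature.MathematicalPhysics.QuantumFieldTheory.Balaban1983to89.B8Eq194CriterionLocalTerms

/-!
# G-B8-19 (c) with BOUNDARY / LOCAL TERMS, part 2: the free box {0, …, LK − 1}^d at EVERY background and for EVERY
# site-local term added to Δ_U (e.g. [4] (3.23)'s Dirichlet boundary masses) — (1.91)'s H′ ≠ [4]'s H′ (3.163)

statement-level skeleton of published theorems with citation tags; proofs where landed; nothing here is a claim
about the Yang–Mills mass gap

Seat p40 gen 10, Phase 2 (free target B, file 2/2; owner r05 row B8.Eq1.91).  Sources: [Balaban1985RegularSpaces]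
T. Bałaban, *Spaces of regular gauge field configurations on a lattice and gauge fixing conditions*, CMP 99 (1985)
75–102: (1.91) p. 91; [Balaban1985BackgroundPropagators] T. Bałaban, *Propagators for lattice gauge theories in a
background field*, CMP 99 (1985) 389–434: (3.19) p. 393, (3.23)–(3.25) p. 394 (verbatim, page image `…-p006-x2.png`: «The
operator Δ^η_U↾Ω₀ is the covariant Laplace operator with Dirichlet boundary conditions on Ω₀^c.»; v1.0.1 replaces the v1.0
fragment-in-guillemets, referee note ref-4 g34 S-B8-g34-1), Thm 3.11 p. 416, (3.163)–(3.165) p. 429; [Balaban1985Averaging]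
(2) p. 17 (the cubes B(y)).

CONTENT (the abstract theorem `not_criterion_of_adjacent_blocks_local` and the data `data_add_AL` /
`exists_data_add_AL` for Δ_U + diag(m) are in the imported companion `B8Eq194CriterionLocalTerms`):
private geometry `box_witness` (part D's cast c′ ∋ 0, l e_{i₀}; c ∋ (l+1) e_{i₀}, extracted as a lemma),
**`not_criterion_box_local`** (L = l + 1 ≥ 2, K ≥ 2, d ≥ 1, any injective transports, bond weights > 0, block weights
≠ 0, contours, centres, ANY site-local P: the criterion Q′(Δ_U + P)N(Q′) = 0 FAILS), **`Hp_ne_H4_box_local`** (any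
(3.25)-data over Δ_U + P with a = diag(a_c) ≠ 0), hypothesis-free **`exists_data_Hp_ne_H4_box_add_AL`** (printed
cubes `yBox`/`ΓBox`, unit bond weights, uniform κ ≠ 0, a_c > 0, ANY m ≥ 0 — e.g. the Dirichlet exit-bond masses:
the data EXIST and the two H′ differ).

NET (with part D and part 3): on the free box with K ≥ 2 cubes per axis, «(1.91)'s H′ = [4]'s H′ (3.163)» fails for
L ≥ 2 at every background under free, periodic AND Dirichlet boundary conditions, and holds for L = 1 for every
operator (`B8Eq194CriterionLocalTerms.H4_eq_Hp_of_subsingleton_blocks_any`).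

HONEST SCOPE.  As in the companion: «Dirichlet» = interior bonds + nonnegative diagonal term on X = Ω₀ (the
restriction from a larger lattice is not typed); failure for any linear site-local P, data existence for P =
diag(m), m ≥ 0; K = 1 and tori elsewhere.  No bound, no row head changes; NOT summit progress.
-/

namespace Literature.MathematicalPhysics.QuantumFieldTheory.Balaban1983to89.B8Eq194CriterionLocalTermsBox

open Finset
open Literature.MathematicalPhysics.QuantumFieldTheory.Balaban1983to89.B9Eq323Ker
  Literature.MathematicalPhysics.QuantumFieldTheory.Balaban1983to89.B9Thm311Lattice
  Literature.MathematicalPhysics.QuantumFieldTheory.Balaban1983to89.B9Thm311Data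
  Literature.MathematicalPhysics.QuantumFieldTheory.Balaban1983to89.B9Eq325Proj
  Literature.MathematicalPhysics.QuantumFieldTheory.Balaban1983to89.B8Eq191Hprime
  Literature.MathematicalPhysics.QuantumFieldTheory.Balaban1983to89.B8Eq194FirstTerm
  Literature.MathematicalPhysics.QuantumFieldTheory.Balaban1983to89.B8Eq194Criterion
  Literature.MathematicalPhysics.QuantumFieldTheory.Balaban1983to89.B8Eq194CriterionLattice
  Literature.MathematicalPhysics.QuantumFieldTheory.Balaban1983to89.B8Eq194CriterionCarriers
  Literature.MathematicalPhysics.QuantumFieldTheory.Balaban1983to89.B8Eq194CriterionCarriersWitness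
  Literature.MathematicalPhysics.QuantumFieldTheory.Balaban1983to89.B8Eq194CriterionCurved
  Literature.MathematicalPhysics.QuantumFieldTheory.Balaban1983to89.B8Eq194CriterionFibre
  Literature.MathematicalPhysics.QuantumFieldTheory.Balaban1983to89.B8Eq194CriterionLocalTerms
open scoped InnerProductSpace

/-! ## §3  The free box at every background and every site-local term -/

section Box

variable (d K l : ℕ) {V : Type*} [NormedAddCommGroup V] [InnerProductSpace ℝ V] [FiniteDimensional ℝ V]

/-- coordinates of `axisSite` (part D's lemma is private). [folklore] -/
private theorem axisSite_val' (i₀ : Fin d) (n : ℕ) (hn : n < nSide K l) (i : Fin d) :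
    (axisSite d K l i₀ n hn i).val = if i = i₀ then n else 0 := by
  unfold axisSite
  split_ifs <;> rfl

/-- coordinates of `axisBlk` (part D's lemma is private). [folklore] -/
private theorem axisBlk_val' (i₀ : Fin d) (m : ℕ) (hm : m < K) (i : Fin d) :
    (axisBlk d K i₀ m hm i).val = if i = i₀ then m else 0 := by
  unfold axisBlk
  split_ifs <;> rfl

/-- **The cast of part D, extracted**: on the free box with L = l + 1 ≥ 2, K ≥ 2, d ≥ 1 the cubes c′ ∋ 0 and c ∋
(l+1)e_{i₀} with the sites x₂ = 0, x₁ = l e_{i₀} ∈ c′, x₀ = (l+1) e_{i₀} ∈ c realise the hypotheses of the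
adjacent-blocks theorem: ⟨x₁, x₀⟩ is a box bond, ⟨x₀, x₁⟩ is not, x₀ is the only site of c bonded to x₁, no site of
c is bonded to x₂. [cite: Balaban1985Averaging, (2) p. 17; Balaban1985BackgroundPropagators, (3.23) p. 394] -/
private theorem box_witness (hd : 0 < d) (hl : 1 ≤ l) (hK : 2 ≤ K) :
    ∃ (c c' : Fin d → Fin K) (x₀ x₁ x₂ : Fin d → Fin (nSide K l)),
      c ≠ c' ∧ x₀ ∈ blocksOf (boxBlk (l + 1) K rfl) c ∧ x₁ ∈ blocksOf (boxBlk (l + 1) K rfl) c' ∧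
      x₂ ∈ blocksOf (boxBlk (l + 1) K rfl) c' ∧ x₁ ≠ x₂ ∧
      (x₁, x₀) ∈ boxBonds (Fin d) (nSide K l) ∧ (x₀, x₁) ∉ boxBonds (Fin d) (nSide K l) ∧
      (∀ x ∈ blocksOf (boxBlk (l + 1) K rfl) c,
        ((x, x₁) ∈ boxBonds (Fin d) (nSide K l) ∨ (x₁, x) ∈ boxBonds (Fin d) (nSide K l)) → x = x₀) ∧
      (∀ x ∈ blocksOf (boxBlk (l + 1) K rfl) c,
        (x, x₂) ∉ boxBonds (Fin d) (nSide K l) ∧ (x₂, x) ∉ boxBonds (Fin d) (nSide K l)) := by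
  set i₀ : Fin d := ⟨0, hd⟩ with hi₀
  have hK2 : (l + 1) * 2 ≤ nSide K l := Nat.mul_le_mul_left (l + 1) hK
  have hn0 : l + 1 < nSide K l := lt_of_lt_of_le (by omega) hK2
  have hn1 : l < nSide K l := lt_trans (Nat.lt_succ_self l) hn0
  have hn2 : 0 < nSide K l := lt_of_le_of_lt (Nat.zero_le l) hn1
  have hK0 : 0 < K := by omega
  have hK1 : 1 < K := by omega
  set c' := axisBlk d K i₀ 0 hK0 with hc'
  set c := axisBlk d K i₀ 1 hK1 with hc
  set x₂ := axisSite d K l i₀ 0 hn2 with hx₂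
  set x₁ := axisSite d K l i₀ l hn1 with hx₁
  set x₀ := axisSite d K l i₀ (l + 1) hn0 with hx₀
  have mx₀ : x₀ ∈ blocksOf (boxBlk (l + 1) K rfl) c := (axisSite_mem_iff d K l i₀ _ hn0 1 hK1).2 (Nat.div_self l.succ_pos)
  have mx₁ : x₁ ∈ blocksOf (boxBlk (l + 1) K rfl) c' :=
    (axisSite_mem_iff d K l i₀ _ hn1 0 hK0).2 (Nat.div_eq_of_lt (Nat.lt_succ_self l))
  have mx₂ : x₂ ∈ blocksOf (boxBlk (l + 1) K rfl) c' := (axisSite_mem_iff d K l i₀ _ hn2 0 hK0).2 (Nat.zero_div _)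
  have hcc : c ≠ c' := by
    intro h
    have h1 := congrArg (fun e : Fin d → Fin K => (e i₀).val) h
    rw [hc, hc', axisBlk_val', axisBlk_val', if_pos rfl, if_pos rfl] at h1
    exact one_ne_zero h1
  have h12 : x₁ ≠ x₂ := by
    intro h
    have h1 := congrArg (fun e : Fin d → Fin (nSide K l) => (e i₀).val) h
    rw [hx₁, hx₂, axisSite_val', axisSite_val', if_pos rfl, if_pos rfl] at h1
    omega
  -- sites of the cube c have i₀-coordinate ≥ L
  have memc : ∀ x ∈ blocksOf (boxBlk (l + 1) K rfl) c, l + 1 ≤ (x i₀).val := by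
    intro x hx
    have h1 := (mem_blocksOf_boxBlk_iff d K l x c).1 hx i₀
    rw [hc, axisBlk_val', if_pos rfl] at h1
    by_contra hlt
    rw [Nat.div_eq_of_lt (by omega)] at h1
    exact zero_ne_one h1
  refine ⟨c, c', x₀, x₁, x₂, hcc, mx₀, mx₁, mx₂, h12, ?_, ?_, ?_, ?_⟩
  · -- ⟨x₁, x₀⟩ = ⟨x₁, x₁ + e_{i₀}⟩ is a box bond
    refine (mem_boxBonds x₁ x₀).2 ⟨i₀, ?_, fun j hj => Fin.ext ?_⟩
    · rw [hx₀, hx₁, axisSite_val', axisSite_val', if_pos rfl, if_pos rfl]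
    · rw [hx₀, hx₁, axisSite_val', axisSite_val', if_neg hj, if_neg hj]
  · -- the reverse orientation is not a box bond
    intro h01
    obtain ⟨i, hi, -⟩ := (mem_boxBonds x₀ x₁).1 h01
    rw [hx₀, hx₁, axisSite_val', axisSite_val'] at hi
    by_cases hii : i = i₀
    · rw [if_pos hii, if_pos hii] at hi
      omega
    · rw [if_neg hii, if_neg hii] at hi
      omega
  · -- x₀ is the only site of the cube c bonded to x₁
    intro x hx hb
    have hge := memc x hx
    rcases hb with hb | hb
    · obtain ⟨i, hi, hrest⟩ := (mem_boxBonds x x₁).1 hb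
      exfalso
      by_cases hii : i = i₀
      · subst hii
        rw [hx₁, axisSite_val', if_pos rfl] at hi
        omega
      · have h1 := congrArg Fin.val (hrest i₀ (Ne.symm hii))
        rw [hx₁, axisSite_val', if_pos rfl] at h1
        omega
    · obtain ⟨i, hi, hrest⟩ := (mem_boxBonds x₁ x).1 hb
      by_cases hii : i = i₀
      · subst hii
        rw [hx₁, axisSite_val', if_pos rfl] at hi
        funext j
        apply Fin.ext
        rw [hx₀, axisSite_val']
        by_cases hj : j = i₀
        · subst hj
          rw [if_pos rfl]
          exact hi
        · rw [if_neg hj, hrest j hj, hx₁, axisSite_val', if_neg hj]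
      · exfalso
        have h1 := congrArg Fin.val (hrest i₀ (Ne.symm hii))
        rw [hx₁, axisSite_val', if_pos rfl] at h1
        omega
  · -- no site of the cube c is bonded to the corner x₂ = 0 of c′
    intro x hx
    have hge := memc x hx
    constructor
    · intro hb
      obtain ⟨i, hi, -⟩ := (mem_boxBonds x x₂).1 hb
      rw [hx₂, axisSite_val'] at hi
      by_cases hii : i = i₀
      · rw [if_pos hii] at hi
        omega
      · rw [if_neg hii] at hi
        omega
    · intro hb
      obtain ⟨i, hi, hrest⟩ := (mem_boxBonds x₂ x).1 hb
      by_cases hii : i = i₀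
      · subst hii
        rw [hx₂, axisSite_val', if_pos rfl] at hi
        omega
      · have h1 := congrArg Fin.val (hrest i₀ (Ne.symm hii))
        rw [hx₂, axisSite_val', if_pos rfl] at h1
        omega

/-- The cube containing a site is unique (the cubes partition the box). [folklore] -/
private theorem blk_eq_of_mem' {x : Fin d → Fin (nSide K l)} {c c' : Fin d → Fin K}
    (h : x ∈ blocksOf (boxBlk (l + 1) K rfl) c) (h' : x ∈ blocksOf (boxBlk (l + 1) K rfl) c') : c = c' :=
  funext fun i => Fin.ext
    (((mem_blocksOf_boxBlk_iff d K l x c).1 h i).symm.trans ((mem_blocksOf_boxBlk_iff d K l x c').1 h' i))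

/-- **The free box, L = l + 1 ≥ 2, K ≥ 2, d ≥ 1: the criterion Q′(Δ_U + P)N(Q′) = 0 FAILS AT EVERY BACKGROUND FOR
EVERY SITE-LOCAL TERM P** — any injective transports, positive bond weights, block weights ≠ 0, contours, centres;
P = [4]'s Dirichlet boundary masses of (3.23), a pointwise potential, or 0 (part D).
[cite: Balaban1985RegularSpaces, (1.91) p. 91; Balaban1985BackgroundPropagators, (3.19) p. 393, (3.23) p. 394;
Balaban1985Averaging, (2) p. 17] -/
theorem not_criterion_box_local (hd : 0 < d) (hl : 1 ≤ l) (hK : 2 ≤ K) [Nontrivial V]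
    (τ : (Fin d → Fin (nSide K l)) → (Fin d → Fin (nSide K l)) → V →ₗ[ℝ] V)
    (hinj : ∀ x x', Function.Injective (τ x x'))
    {cb : (Fin d → Fin (nSide K l)) × (Fin d → Fin (nSide K l)) → ℝ}
    (hcb : ∀ b ∈ boxBonds (Fin d) (nSide K l), 0 < cb b)
    {w : (Fin d → Fin K) → (Fin d → Fin (nSide K l)) → ℝ}
    (hw : ∀ c, ∀ x ∈ blocksOf (boxBlk (l + 1) K rfl) c, w c x ≠ 0)
    (Γ : (Fin d → Fin K) → (Fin d → Fin (nSide K l)) → List (Fin d → Fin (nSide K l)))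
    (y : (Fin d → Fin K) → Fin d → Fin (nSide K l))
    (P : PiLp 2 (fun _ : Fin d → Fin (nSide K l) => V) →ₗ[ℝ] PiLp 2 (fun _ : Fin d → Fin (nSide K l) => V))
    (hP : ∀ f x, f x = 0 → P f x = 0) :
    ¬ ∀ f, qL τ w (blocksOf (boxBlk (l + 1) K rfl)) Γ y f = 0 →
        qL τ w (blocksOf (boxBlk (l + 1) K rfl)) Γ y ((lapL τ (boxBonds (Fin d) (nSide K l)) cb + P) f) = 0 := by
  obtain ⟨c, c', x₀, x₁, x₂, hcc, mx₀, mx₁, mx₂, h12, h10, h01, huniq, hfar⟩ := box_witness d K l hd hl hK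
  exact not_criterion_of_adjacent_blocks_local τ cb w (blocksOf (boxBlk (l + 1) K rfl)) Γ y hinj hcb P hP hcc mx₀ mx₁
    mx₂ h12 (fun c'' h => blk_eq_of_mem' d K l h mx₁) (fun c'' h => blk_eq_of_mem' d K l h mx₂) (hw c x₀ mx₀)
    (hw c' x₂ mx₂) (Or.inr h10) (fun h => absurd h h01) huniq hfar

/-- **The free box, L ≥ 2, K ≥ 2, d ≥ 1, EVERY background, EVERY site-local term: (1.91)'s H′ ≠ [4]'s H′ (3.163)** for
every (3.25)-data over (Δ_U + P, Q′, Q′\*, a = diag(a_c)), a_c ≠ 0. [cite: Balaban1985RegularSpaces, (1.91) p. 91;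
Balaban1985BackgroundPropagators, (3.23)–(3.25) p. 394, (3.163)–(3.165) p. 429] -/
theorem Hp_ne_H4_box_local (hd : 0 < d) (hl : 1 ≤ l) (hK : 2 ≤ K) [Nontrivial V]
    (τ : (Fin d → Fin (nSide K l)) → (Fin d → Fin (nSide K l)) → V →ₗ[ℝ] V)
    (hinj : ∀ x x', Function.Injective (τ x x'))
    {cb : (Fin d → Fin (nSide K l)) × (Fin d → Fin (nSide K l)) → ℝ}
    (hcb : ∀ b ∈ boxBonds (Fin d) (nSide K l), 0 < cb b)
    {w : (Fin d → Fin K) → (Fin d → Fin (nSide K l)) → ℝ}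
    (hw : ∀ c, ∀ x ∈ blocksOf (boxBlk (l + 1) K rfl) c, w c x ≠ 0)
    (Γ : (Fin d → Fin K) → (Fin d → Fin (nSide K l)) → List (Fin d → Fin (nSide K l)))
    (y : (Fin d → Fin K) → Fin d → Fin (nSide K l))
    (P : PiLp 2 (fun _ : Fin d → Fin (nSide K l) => V) →ₗ[ℝ] PiLp 2 (fun _ : Fin d → Fin (nSide K l) => V))
    (hP : ∀ f x, f x = 0 → P f x = 0) (a : (Fin d → Fin K) → ℝ) (ha : ∀ c, a c ≠ 0)
    {g : PiLp 2 (fun _ : Fin d → Fin (nSide K l) => V) →ₗ[ℝ] PiLp 2 (fun _ : Fin d → Fin (nSide K l) => V)}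
    {cc : PiLp 2 (fun _ : Fin d → Fin K => V) →ₗ[ℝ] PiLp 2 (fun _ : Fin d → Fin K => V)}
    (hdata : Data (lapL τ (boxBonds (Fin d) (nSide K l)) cb + P) (qL τ w (blocksOf (boxBlk (l + 1) K rfl)) Γ y)
      (LinearMap.adjoint (qL τ w (blocksOf (boxBlk (l + 1) K rfl)) Γ y)) (AL a) g cc) :
    ∃ μ, Hp (LinearMap.adjoint (qL τ w (blocksOf (boxBlk (l + 1) K rfl)) Γ y)) g cc μ
      ≠ H4 (qL τ w (blocksOf (boxBlk (l + 1) K rfl)) Γ y)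
          (LinearMap.adjoint (qL τ w (blocksOf (boxBlk (l + 1) K rfl)) Γ y)) (AL a) g cc μ := by
  by_contra hall
  refine not_criterion_box_local d K l hd hl hK τ hinj hcb hw Γ y P hP
    (criterion_of_H4_eq_Hp hdata (AL_surjectiveV a ha) fun μ => ?_)
  by_contra hμ
  exact hall ⟨μ, fun e => hμ e.symm⟩

/-- **Hypothesis-free, Dirichlet-type data: on the printed cubes (corner centres `yBox`, axis-by-axis contours `ΓBox`,
uniform κ ≠ 0, unit bond weights) the (3.25)-data for Δ_U + diag(m) EXIST AT EVERY BACKGROUND for every m ≥ 0 (e.g.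
the exit-bond masses of (3.23)'s Dirichlet condition) and (1.91)'s H′ ≠ [4]'s H′ on them** (L ≥ 2, K ≥ 2, d ≥ 1).
[cite: Balaban1985RegularSpaces, (1.91) p. 91; Balaban1985BackgroundPropagators, (3.18)–(3.19) p. 393,
(3.23)–(3.25) p. 394, Thm 3.11 p. 416, (3.163)–(3.165) p. 429; Balaban1985Averaging, (2) p. 17] -/
theorem exists_data_Hp_ne_H4_box_add_AL (hd : 0 < d) (hl : 1 ≤ l) (hK : 2 ≤ K) [Nontrivial V]
    (τ : (Fin d → Fin (nSide K l)) → (Fin d → Fin (nSide K l)) → V →ₗ[ℝ] V)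
    (hinj : ∀ x x', Function.Injective (τ x x')) {κ : ℝ} (hκ : κ ≠ 0)
    (m : (Fin d → Fin (nSide K l)) → ℝ) (hm : ∀ x, 0 ≤ m x) (a : (Fin d → Fin K) → ℝ) (ha : ∀ c, 0 < a c) :
    ∃ (g : PiLp 2 (fun _ : Fin d → Fin (nSide K l) => V) →ₗ[ℝ] PiLp 2 (fun _ : Fin d → Fin (nSide K l) => V))
      (cc : PiLp 2 (fun _ : Fin d → Fin K => V) →ₗ[ℝ] PiLp 2 (fun _ : Fin d → Fin K => V)),
      Data (lapL τ (boxBonds (Fin d) (nSide K l)) (fun _ => 1) + AL m)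
          (qL τ (fun _ _ => κ) (blocksOf (boxBlk (l + 1) K rfl)) (ΓBox d K l) (yBox d K l))
          (LinearMap.adjoint (qL τ (fun _ _ => κ) (blocksOf (boxBlk (l + 1) K rfl)) (ΓBox d K l) (yBox d K l)))
          (AL a) g cc ∧
        ∃ μ, Hp (LinearMap.adjoint (qL τ (fun _ _ => κ) (blocksOf (boxBlk (l + 1) K rfl)) (ΓBox d K l) (yBox d K l)))
            g cc μ
          ≠ H4 (qL τ (fun _ _ => κ) (blocksOf (boxBlk (l + 1) K rfl)) (ΓBox d K l) (yBox d K l))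
              (LinearMap.adjoint (qL τ (fun _ _ => κ) (blocksOf (boxBlk (l + 1) K rfl)) (ΓBox d K l) (yBox d K l)))
              (AL a) g cc μ := by
  have hcb : ∀ b ∈ boxBonds (Fin d) (nSide K l), (0 : ℝ) < (fun _ => (1 : ℝ)) b := fun _ _ => one_pos
  have hS := isBlockSystem_box d K l hκ
  obtain ⟨g, cc, hdata⟩ := exists_data_add_AL τ (fun _ => 1) m a hinj hcb hS hm ha
  exact ⟨g, cc, hdata, Hp_ne_H4_box_local d K l hd hl hK τ hinj hcb (fun _ _ _ => hκ) _ _ (AL m) (AL_local m) a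
    (fun c => (ha c).ne') hdata⟩

end Box

end Literature.MathematicalPhysics.QuantumFieldTheory.Balaban1983to89.B8Eq194CriterionLocalTermsBox
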